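import Summits.QuantumFields.YangMills.Theorems.UnitScaleTiltProp7CovLinAvgStructureStep
import HarnessLib

/-!
# Route `UnitScaleTilt`, crux K1 «MinimiserStabilityRegPr» (stmt-QuantumFields-19200), route-R [RP] curved, the curved N6 row (R-A) — ONE STEP, ANALYTIC HALF:
# THE REDUCED TRUE ONE-STEP OPERATOR `T(V) − P_{V̄}∘CM_V` IS THE COMB-TRANSPORTED COVARIANT STRAIGHT-LINE MEAN UP TO `159·α·m`
# (`CM_V` the covariant comb mean, `V̄ = avgFun ℰp V`, `α` the size of the (0.4) loop variables of `V` at `c`, `m` a bound of the walk masses of `Z` at `c`)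

Cell `ym3-torus`, width seat `ym-ust-20520-w2` (g3); assembly of brick 1 (✓ p602235 `…CovLinAvgStructureStep.norm_covLinAvgR0_sub_structure_le`), ★p1 g4's
`Prop7HolRatioPerStep.norm_trueLin_sub_covLinAvg_le` (✓ `…AvgTrueLinearisationDiff`), the tree's `covLinAvg_sub_covLinAvgR0` and `dist1_corr_le_two_mul`.  It is the
one-step input of the structure recursion `…Prop7TrueLinIterStructure.trueLinIter_structure` at the choice `CM_j :=` covariant comb mean: there `G_{j+1} = T_jG_j −
P_{Ū₀^{(j+1)}}(CM_jG_j)`, and THIS file says `G_{j+1}(c) = LINE_j(G_j)(c) + D_j(c)` with `‖D_j(c)‖ ≤ 159·α_j·m_j(c)`.  THEOREMS ONLY (0 `def`, 0 `sorry`);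
`--supports stmt-QuantumFields-19200`, count-neutral.  YM₃ on T³ is a ladder rung (R3), not the Clay problem; nothing here claims the curved N6 bounds, S2, P, the crux or the gap.

THE LETTERS (all written out; `V` a level-`j` `SU(N)` background, `Z` a level-`j` bond field, `c = ⟨y, μ⟩` a coarse bond, `I = Idx P`).
`T(V)Z(c) = D eml(W)[i ↦ Z_V(loop_i)·W_i]·κ* + κ·Z_V([y,y′])·κ*` (the true linearisation); `CM_VZ(z) = |I|⁻¹Σ_i Z_V(Γ^{σ_i}_{emb z → x_i})` (covariant comb mean,
combs `stairWord i.2.1 (off i.1)`); `LINE_VZ(c) = |I|⁻¹Σ_i A_i·Z_V([x_i, x_i′])·A_i*` (`A_i = V(Γ^{σ_i}_{y→x_i})`, the comb-transported covariant straight-line mean);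
`P_{V̄}ξ(c) = ξ(c₋) − V̄(c)·ξ(c₊)·V̄(c)*`, `V̄ = avgFun ℰp V`.

WHAT IS PROVED (ns `…Theorems.Prop7TrueLinReducedStep`).
* §1 `combMean_cov_reindex` — the comb mean at `c₊` indexed by `σ′_i = i.2.2` (brick 1's `CM′`) equals the one indexed by `σ_i = i.2.1` (tree `sum_idx_swap`).
* §2 `norm_sub_conj_le` (`‖X − WXW*‖ ≤ 2‖W − 1‖‖X‖`), `norm_covLinAvg_sub_covLinAvgR0_le` (`≤ 2α·m`).
* §3 `norm_conj_avgFun_sub_conj_axialAvg_le` — `‖V̄XV̄* − aXa*‖ ≤ 4α‖X‖` (`a = axialAvg V c`, `V̄ = κ·a`, `dist1 κ ≤ 2α`).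
* §4 ★★ `norm_reduced_sub_line_le` — `‖T(V)Z(c) − P_{V̄}(CM_VZ)(c) − LINE_VZ(c)‖ ≤ 159·α·m` under `dist1(W_i) ≤ α ≤ 1/24`, `α < δ_N`, and `m` bounding the walk
  masses of `Z` along the (0.4) loops at `c`, the segment `[y,y′]`, and the combs at `c₊`.
HONEST SCOPE.  One step; sup-type (walk-mass) defect.  The `k`-fold identification of the iterated `LINE` with the engine's `A^{U₀}` (transport geometry) and the `ℓ²`
weights of row (R-C), and the `(H¹)^*` bound of `Λ` (row (R-B)), are not here.

References: T. Bałaban, CMP 98 (1985) 17–51 [Balaban1985Averaging] (Prop. 3 (122)–(125) p.36, (62)–(63) p.28); CMP 109 (1987) 249–301 [Balaban1987RG1] ((0.4)–(0.5) p.253);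
CMP 95 (1984) 17–40 [Balaban1984PropagatorsI] ((1.18)–(1.20) pp.19–20).
-/

noncomputable section

open scoped BigOperators Matrix.Norms.L2Operator

namespace Summit.QuantumFields.YangMills.Theorems.Prop7TrueLinReducedStep

open Literature.MathematicalPhysics.QuantumFieldTheory.Balaban1983to89
open Finset T4Continuum BlockAveraging AveragingRT ExpMeanLog BlockAveragingEMLLinearised BlockAveragingEMLLinearisedBackground BlockAveragingEMLProp2
open Summit.QuantumFields.YangMills.Theorems.Prop7HolRatioPerStep (norm_coe_eq_one norm_star_coe_eq_one norm_covWalkSum_le_mass norm_mean_le'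
  norm_trueLin_sub_covLinAvg_le)
open Summit.QuantumFields.YangMills.Theorems.Prop7CovLinAvgStructureStep (norm_conj_mul_sub_conj_le norm_covLinAvgR0_sub_structure_le)

variable {P : Params} {n : Type*} [Fintype n] [DecidableEq n] [Nonempty n] {j : ℕ}

/-! ## §1 The two comb means at `c₊` agree (reindexing `σ ↔ σ′`) -/

omit [Nonempty n] in
/-- The covariant comb mean at a coarse site indexed through `σ′_i = i.2.2` equals the one indexed through `σ_i = i.2.1`. [cite: Balaban1985Averaging, (62) p.28] -/
theorem combMean_cov_reindex (V : GaugeField P j (Matrix.specialUnitaryGroup n ℂ)) (Z : PBond P j → Matrix n n ℂ) (z : Site P (j + 1)) :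
    ((Fintype.card (Idx P) : ℂ))⁻¹ • ∑ i : Idx P, covWalkSum V Z (walk (emb z) (stairWord i.2.2 (off i.1)))
      = ((Fintype.card (Idx P) : ℂ))⁻¹ • ∑ i : Idx P, covWalkSum V Z (walk (emb z) (stairWord i.2.1 (off i.1))) := by
  rw [sum_idx_swap (fun r σ => covWalkSum V Z (walk (emb z) (stairWord σ (off r))))]

/-! ## §2 `covLinAvg` versus its `R₀` form -/

/-- `‖X − W·X·W*‖ ≤ 2‖W − 1‖·‖X‖` for special-unitary `W`. [folklore] -/
theorem norm_sub_conj_le (W : Matrix.specialUnitaryGroup n ℂ) (X : Matrix n n ℂ) :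
    ‖X - (W : Matrix n n ℂ) * X * star (W : Matrix n n ℂ)‖ ≤ 2 * ‖(W : Matrix n n ℂ) - 1‖ * ‖X‖ := by
  have e : X - (W : Matrix n n ℂ) * X * star (W : Matrix n n ℂ)
      = -(((W : Matrix n n ℂ) - 1) * X * star (W : Matrix n n ℂ) + X * (star (W : Matrix n n ℂ) - 1)) := by noncomm_ring
  have hs : ‖star (W : Matrix n n ℂ) - 1‖ = ‖(W : Matrix n n ℂ) - 1‖ := by
    rw [show star (W : Matrix n n ℂ) - 1 = star ((W : Matrix n n ℂ) - 1) by rw [star_sub, star_one], norm_star]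
  rw [e, norm_neg]
  calc _ ≤ ‖(W : Matrix n n ℂ) - 1‖ * ‖X‖ * ‖star (W : Matrix n n ℂ)‖ + ‖X‖ * ‖star (W : Matrix n n ℂ) - 1‖ :=
        (norm_add_le _ _).trans (add_le_add ((norm_mul_le _ _).trans (mul_le_mul_of_nonneg_right (norm_mul_le _ _) (norm_nonneg _))) (norm_mul_le _ _))
    _ = 2 * ‖(W : Matrix n n ℂ) - 1‖ * ‖X‖ := by rw [norm_star_coe_eq_one, hs]; ring

/-- `‖covLinAvg V Z c − covLinAvgR0 V Z c‖ ≤ 2α·m`: the two forms differ by the mean of the conjugation defects `S − W_iSW_i*` of the segment sum `S = Z_V([y,y′])`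
(tree `covLinAvg_sub_covLinAvgR0`), each `≤ 2‖W_i − 1‖·‖S‖`. [cite: Balaban1985Averaging, (124) p.36] -/
theorem norm_covLinAvg_sub_covLinAvgR0_le (V : GaugeField P j (Matrix.specialUnitaryGroup n ℂ)) (Z : PBond P j → Matrix n n ℂ) (c : PBond P (j + 1))
    {m α : ℝ} (hmS : ((walk (emb c.src) (List.replicate P.L (c.dir, true))).map fun s => ‖Z s.bond‖).sum ≤ m)
    (hα : ∀ i : Idx P, dist1 (loopHol V c i) ≤ α) :
    ‖covLinAvg V Z c - covLinAvgR0 V Z c‖ ≤ 2 * α * m := by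
  have hm0 : 0 ≤ m := (List.sum_nonneg fun y hy => by obtain ⟨z, _, rfl⟩ := List.mem_map.mp hy; exact norm_nonneg _).trans hmS
  have hα0 : 0 ≤ α := (GaugeGroup.dist1_nonneg _).trans (hα (Classical.arbitrary _))
  have hS : ‖covWalkSum V Z (walk (emb c.src) (List.replicate P.L (c.dir, true)))‖ ≤ m := (norm_covWalkSum_le_mass V Z _).trans hmS
  rw [covLinAvg_sub_covLinAvgR0]
  refine norm_mean_le' fun i => ?_
  have hW : ‖((loopHol V c i : Matrix.specialUnitaryGroup n ℂ) : Matrix n n ℂ) - 1‖ ≤ α := by rw [← FederbushMean.dist1_SU_eq]; exact hα i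
  calc _ ≤ 2 * ‖((loopHol V c i : Matrix.specialUnitaryGroup n ℂ) : Matrix n n ℂ) - 1‖ * ‖covWalkSum V Z (walk (emb c.src) (List.replicate P.L (c.dir, true)))‖ :=
        (norm_sub_conj_le _ _)
    _ ≤ 2 * α * m := by
        nlinarith [norm_nonneg (((loopHol V c i : Matrix.specialUnitaryGroup n ℂ) : Matrix n n ℂ) - 1),
          norm_nonneg (covWalkSum V Z (walk (emb c.src) (List.replicate P.L (c.dir, true)))), mul_le_mul hW hS (norm_nonneg _) hα0]

/-! ## §3 Transport by `V̄ = κ·a` versus transport by the straight coarse bond `a` -/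

/-- `‖V̄(c)·X·V̄(c)* − a·X·a*‖ ≤ 4α·‖X‖` with `a = axialAvg V c`, `V̄(c) = avgFun ℰp V c = κ_c·a` and `dist1 κ_c ≤ 2α` (`dist1_corr_le_two_mul`; needs `α ≤ 1/6`, `α < δ_N`).
[cite: Balaban1987RG1, (0.4)-(0.5) p.253] -/
theorem norm_conj_avgFun_sub_conj_axialAvg_le (V : GaugeField P j (Matrix.specialUnitaryGroup n ℂ)) (c : PBond P (j + 1)) (X : Matrix n n ℂ)
    {α : ℝ} (hα : ∀ i : Idx P, dist1 (loopHol V c i) ≤ α) (hα6 : α ≤ 1 / 6) (hN : α < deltaSU n) :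
    ‖((avgFun (expMeanLogSU (n := n)) V c : Matrix.specialUnitaryGroup n ℂ) : Matrix n n ℂ) * X
          * star ((avgFun (expMeanLogSU (n := n)) V c : Matrix.specialUnitaryGroup n ℂ) : Matrix n n ℂ)
        - ((axialAvg V c : Matrix.specialUnitaryGroup n ℂ) : Matrix n n ℂ) * X * star ((axialAvg V c : Matrix.specialUnitaryGroup n ℂ) : Matrix n n ℂ)‖
      ≤ 4 * α * ‖X‖ := by
  have hκ : ‖((corr (expMeanLogSU (n := n)) V c : Matrix.specialUnitaryGroup n ℂ) : Matrix n n ℂ) - 1‖ ≤ 2 * α := by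
    rw [← FederbushMean.dist1_SU_eq]; exact dist1_corr_le_two_mul V c hα hN hα6
  have havg : avgFun (expMeanLogSU (n := n)) V c = corr (expMeanLogSU (n := n)) V c * axialAvg V c := rfl
  rw [havg]
  calc _ ≤ 2 * ‖((corr (expMeanLogSU (n := n)) V c : Matrix.specialUnitaryGroup n ℂ) : Matrix n n ℂ) - 1‖ * ‖X‖ := norm_conj_mul_sub_conj_le _ _ X
    _ ≤ 4 * α * ‖X‖ := by nlinarith [norm_nonneg X, hκ]

/-! ## §4 ★★ The reduced true one-step operator is the comb-transported covariant straight-line mean up to `159·α·m` -/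

/-- ★★ **THE REDUCED TRUE ONE-STEP OPERATOR.**  Let `V` be a level-`j` `SU(N)` background whose (0.4) loop variables at the coarse bond `c` satisfy `dist1(W_i) ≤ α`,
`α ≤ 1/24`, `α < δ_N`; let `Z` be a level-`j` bond field whose walk masses `Σ_{s∈walk}‖Z(s.bond)‖` along the (0.4) loops at `c`, the straight segment `[y,y′]` and the
combs at `c₊` are all `≤ m`.  Then, with the letters of the module docstring,
`‖T(V)Z(c) − (CM_VZ(c₋) − V̄(c)·CM_VZ(c₊)·V̄(c)*) − LINE_VZ(c)‖ ≤ 159·α·m`: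
the true linearisation minus the coarse covariant gradient of the covariant comb mean IS the comb-transported covariant straight-line mean up to an `O(α)`-small
linear defect (`151αm`: true derivative vs `covLinAvg`, ★p1 g4; `2αm`: `covLinAvg` vs `R₀` form; `2αm`: brick 1; `4αm`: `V̄ = κa` vs `a`).
[cite: Balaban1985Averaging, Prop. 3 (124)-(125) p.36] -/
theorem norm_reduced_sub_line_le (V : GaugeField P j (Matrix.specialUnitaryGroup n ℂ)) (Z : PBond P j → Matrix n n ℂ) (c : PBond P (j + 1)) {m α : ℝ}
    (hmL : ∀ i : Idx P, ((walk (emb c.src) (loopWord P.L c.dir (off i.1) i.2.1 i.2.2)).map fun s => ‖Z s.bond‖).sum ≤ m)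
    (hmS : ((walk (emb c.src) (List.replicate P.L (c.dir, true))).map fun s => ‖Z s.bond‖).sum ≤ m)
    (hmC : ∀ (σ : Equiv.Perm (Fin P.d)) (r : Fin P.d → Fin P.L), ((walk (emb c.tgt) (stairWord σ (off r))).map fun s => ‖Z s.bond‖).sum ≤ m)
    (hα : ∀ i : Idx P, dist1 (loopHol V c i) ≤ α) (hα24 : α ≤ 1 / 24) (hN : α < deltaSU n) :
    ‖(fderiv ℂ (eml : (Idx P → Matrix n n ℂ) → Matrix n n ℂ) (fun i => ((loopHol V c i : Matrix.specialUnitaryGroup n ℂ) : Matrix n n ℂ))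
          (fun i => covWalkSum V Z (walk (emb c.src) (loopWord P.L c.dir (off i.1) i.2.1 i.2.2))
            * ((loopHol V c i : Matrix.specialUnitaryGroup n ℂ) : Matrix n n ℂ))
          * star ((corr (expMeanLogSU (n := n)) V c : Matrix.specialUnitaryGroup n ℂ) : Matrix n n ℂ)
        + ((corr (expMeanLogSU (n := n)) V c : Matrix.specialUnitaryGroup n ℂ) : Matrix n n ℂ)
          * covWalkSum V Z (walk (emb c.src) (List.replicate P.L (c.dir, true)))
          * star ((corr (expMeanLogSU (n := n)) V c : Matrix.specialUnitaryGroup n ℂ) : Matrix n n ℂ))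
      - ((((Fintype.card (Idx P) : ℂ))⁻¹ • ∑ i : Idx P, covWalkSum V Z (walk (emb c.src) (stairWord i.2.1 (off i.1))))
          - ((avgFun (expMeanLogSU (n := n)) V c : Matrix.specialUnitaryGroup n ℂ) : Matrix n n ℂ)
              * (((Fintype.card (Idx P) : ℂ))⁻¹ • ∑ i : Idx P, covWalkSum V Z (walk (emb c.tgt) (stairWord i.2.1 (off i.1))))
              * star ((avgFun (expMeanLogSU (n := n)) V c : Matrix.specialUnitaryGroup n ℂ) : Matrix n n ℂ))
      - ((Fintype.card (Idx P) : ℂ))⁻¹ • ∑ i : Idx P,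
          ((holAt V (walk (emb c.src) (stairWord i.2.1 (off i.1))) : Matrix.specialUnitaryGroup n ℂ) : Matrix n n ℂ) *
            covWalkSum V Z (walk (walkEnd (emb c.src) (stairWord i.2.1 (off i.1))) (List.replicate P.L (c.dir, true))) *
          star ((holAt V (walk (emb c.src) (stairWord i.2.1 (off i.1))) : Matrix.specialUnitaryGroup n ℂ) : Matrix n n ℂ)‖
      ≤ 159 * α * m := by
  have hm0 : 0 ≤ m := (List.sum_nonneg fun y hy => by obtain ⟨z, _, rfl⟩ := List.mem_map.mp hy; exact norm_nonneg _).trans hmS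
  have hα0 : 0 ≤ α := (GaugeGroup.dist1_nonneg _).trans (hα (Classical.arbitrary _))
  -- abbreviations
  set T : Matrix n n ℂ := fderiv ℂ (eml : (Idx P → Matrix n n ℂ) → Matrix n n ℂ) (fun i => ((loopHol V c i : Matrix.specialUnitaryGroup n ℂ) : Matrix n n ℂ))
          (fun i => covWalkSum V Z (walk (emb c.src) (loopWord P.L c.dir (off i.1) i.2.1 i.2.2))
            * ((loopHol V c i : Matrix.specialUnitaryGroup n ℂ) : Matrix n n ℂ))
          * star ((corr (expMeanLogSU (n := n)) V c : Matrix.specialUnitaryGroup n ℂ) : Matrix n n ℂ)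
        + ((corr (expMeanLogSU (n := n)) V c : Matrix.specialUnitaryGroup n ℂ) : Matrix n n ℂ)
          * covWalkSum V Z (walk (emb c.src) (List.replicate P.L (c.dir, true)))
          * star ((corr (expMeanLogSU (n := n)) V c : Matrix.specialUnitaryGroup n ℂ) : Matrix n n ℂ) with hT
  set CM : Matrix n n ℂ := ((Fintype.card (Idx P) : ℂ))⁻¹ • ∑ i : Idx P, covWalkSum V Z (walk (emb c.src) (stairWord i.2.1 (off i.1))) with hCM
  set CMt : Matrix n n ℂ := ((Fintype.card (Idx P) : ℂ))⁻¹ • ∑ i : Idx P, covWalkSum V Z (walk (emb c.tgt) (stairWord i.2.1 (off i.1))) with hCMt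
  set CMt' : Matrix n n ℂ := ((Fintype.card (Idx P) : ℂ))⁻¹ • ∑ i : Idx P, covWalkSum V Z (walk (emb c.tgt) (stairWord i.2.2 (off i.1))) with hCMt'
  set LINE : Matrix n n ℂ := ((Fintype.card (Idx P) : ℂ))⁻¹ • ∑ i : Idx P,
          ((holAt V (walk (emb c.src) (stairWord i.2.1 (off i.1))) : Matrix.specialUnitaryGroup n ℂ) : Matrix n n ℂ) *
            covWalkSum V Z (walk (walkEnd (emb c.src) (stairWord i.2.1 (off i.1))) (List.replicate P.L (c.dir, true))) *
          star ((holAt V (walk (emb c.src) (stairWord i.2.1 (off i.1))) : Matrix.specialUnitaryGroup n ℂ) : Matrix n n ℂ) with hLINE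
  set vb : Matrix n n ℂ := ((avgFun (expMeanLogSU (n := n)) V c : Matrix.specialUnitaryGroup n ℂ) : Matrix n n ℂ) with hvb
  set a : Matrix n n ℂ := ((axialAvg V c : Matrix.specialUnitaryGroup n ℂ) : Matrix n n ℂ) with ha
  -- the comb mean at `c₊`: the two indexings agree, and its size
  have hCMeq : CMt' = CMt := combMean_cov_reindex V Z c.tgt
  have hCMtn : ‖CMt‖ ≤ m := by
    rw [← hCMeq, hCMt']
    exact norm_mean_le' fun i => (norm_covWalkSum_le_mass V Z _).trans (hmC i.2.2 i.1)
  -- the four pieces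
  have h1 : ‖T - covLinAvg V Z c‖ ≤ 151 * α * m := norm_trueLin_sub_covLinAvg_le V Z c hmL hmS hα hα24 hN
  have h2 : ‖covLinAvg V Z c - covLinAvgR0 V Z c‖ ≤ 2 * α * m := norm_covLinAvg_sub_covLinAvgR0_le V Z c hmS hα
  have h3 : ‖covLinAvgR0 V Z c - (CM + LINE - a * CMt' * star a)‖
      ≤ 2 * α * (((Fintype.card (Idx P) : ℝ))⁻¹ * ∑ i : Idx P, ((walk (emb c.tgt) (stairWord i.2.2 (off i.1))).map fun s => ‖Z s.bond‖).sum) :=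
    norm_covLinAvgR0_sub_structure_le V Z c hα
  have h3' : ((Fintype.card (Idx P) : ℝ))⁻¹ * ∑ i : Idx P, ((walk (emb c.tgt) (stairWord i.2.2 (off i.1))).map fun s => ‖Z s.bond‖).sum ≤ m := by
    have hI : (0 : ℝ) < (Fintype.card (Idx P) : ℝ) := by exact_mod_cast Fintype.card_pos
    rw [inv_mul_le_iff₀ hI]
    calc ∑ i : Idx P, ((walk (emb c.tgt) (stairWord i.2.2 (off i.1))).map fun s => ‖Z s.bond‖).sum ≤ ∑ _i : Idx P, m :=
          Finset.sum_le_sum fun i _ => hmC i.2.2 i.1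
      _ = (Fintype.card (Idx P) : ℝ) * m := by rw [Finset.sum_const, Finset.card_univ, nsmul_eq_mul]
  have h4 : ‖vb * CMt * star vb - a * CMt * star a‖ ≤ 4 * α * ‖CMt‖ :=
    norm_conj_avgFun_sub_conj_axialAvg_le V c CMt hα (hα24.trans (by norm_num)) hN
  -- assemble
  have e : T - (CM - vb * CMt * star vb) - LINE
      = (T - covLinAvg V Z c) + (covLinAvg V Z c - covLinAvgR0 V Z c) + (covLinAvgR0 V Z c - (CM + LINE - a * CMt' * star a))
        + (vb * CMt * star vb - a * CMt * star a) := by rw [hCMeq]; abel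
  rw [e]
  calc _ ≤ ‖T - covLinAvg V Z c‖ + ‖covLinAvg V Z c - covLinAvgR0 V Z c‖ + ‖covLinAvgR0 V Z c - (CM + LINE - a * CMt' * star a)‖
          + ‖vb * CMt * star vb - a * CMt * star a‖ :=
        (norm_add_le _ _).trans (add_le_add ((norm_add_le _ _).trans (add_le_add (norm_add_le _ _) le_rfl)) le_rfl)
    _ ≤ 151 * α * m + 2 * α * m + 2 * α * m + 4 * α * m := by
        refine add_le_add (add_le_add (add_le_add h1 h2) (h3.trans ?_)) (h4.trans ?_)
        · exact mul_le_mul_of_nonneg_left h3' (by positivity)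
        · exact mul_le_mul_of_nonneg_left hCMtn (by positivity)
    _ = 159 * α * m := by ring

end Summit.QuantumFields.YangMills.Theorems.Prop7TrueLinReducedStep

end
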